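import Literature.IUT.LogVolume.WildGaussianIsometryMover
import Literature.IUT.LogVolume.UltrametricIsometryExtension
import Mathlib.NumberTheory.Padics.RingHoms
import HarnessLib

/-!
# A print-shaped wild DYADIC isometry mover: `K ⊇ ℚ₂(√−1, ζ₃) = ℚ₂(ζ₁₂)` — no degree hypothesis

[IUTchI] Def. 3.1 (a)(b) makes `√−1 ∈ F` and (via `E_F[6]`-rationality) `ζ₃ ∈ F`, so EVERY completion `F_w` at a
place `w ∣ 2` of print-shaped initial Θ-data contains `ℚ₂(ζ₁₂) = ℚ₂(i, ζ)` (`i² = −1`, `ζ² + ζ + 1 = 0`;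
`e = f = 2`).  For ANY nontrivially normed field `K`, normed `ℚ₂`-algebra, ultrametric and proper, containing such
`i, ζ`, we exhibit a `ℚ₂`-linear ISOMETRY `g` of `K` and a point `z` of the maximal order `(R_I)^∼` of the two-factor
packet `K ⊗_{ℚ₂} K` with `(g ⊗ 1)(z) ∉ (R_I)^∼`:

* `z = 6⁻¹·(1⊗1 + ζ⊗ζ² + ζ²⊗ζ − i⊗i − iζ⊗iζ² − iζ²⊗iζ) = (1 − i⊗i)·(1 + ζ⊗ζ² + ζ²⊗ζ)/6` is an idempotent
  (`A² = 2A`, `B² = 3B`), hence integral over `R_I` (`cycIdempotent_mem_normalizedPacket`);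
* the unit-layer SHEAR `g : 1 ↦ 1, ζ ↦ ζ + 1, i ↦ i, iζ ↦ iζ − 1` (equivalently: fixes `1, 1+i, ζ(1+i)` and
  sends `ζ ↦ ζ + 1`) moves `z` to `z + 6⁻¹·ι₁((1+i)(ζ² − ζ))`, and the `ι₁`-coordinate has norm
  `‖6⁻¹‖·‖1+i‖·‖ζ²−ζ‖ = 2·2^{−1/2}·1 = √2 > 1`, so `(g ⊗ 1)(z) ∉ (R_I)^∼` (`norm_dEquiv_iota`);
* `g` is an isometry on `D = ⟨1, ζ, 1+i, ζ(1+i)⟩_{ℚ₂}` by the norm formula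
  `‖a·1 + b·ζ + c·π + d·ζπ‖ = max (max ‖a‖ ‖b‖) (max ‖c‖ ‖d‖ · ‖π‖)` (`‖π‖² = 2⁻¹`; the unit-layer part rests on
  the residue-field fact `‖u − 1‖ < 1` for `‖u‖ = 1` in `ℚ₂`, i.e. `𝔽₂ = {0,1}`), and is EXTENDED to an isometry
  of all of `K` by `UltrametricComplement.exists_isometry_extension` — so NO `finrank` hypothesis is needed and the
  exhibit instantiates at the actual completions `F_w`, `w ∣ 2`, of print-shaped data (row Y-29b (S) of the R-J census).

Non-vacuity: `ℚ₂(ζ₁₂) ⊆ ℚ̄₂` (`exists_dyadicCyclotomic_subfield`).  Proof-only module (no new definitions); the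
pair-packet algebra (`congr_pair_purePacket`, `purePacket_pair_mul`, …) is abc-iut-E-t16's `WildQuadratic.*`, and `‖i‖ = 1`,
`‖1+i‖² = 2⁻¹`, `‖2‖ = 2⁻¹` are abc-iut-E-t44's `WildGaussian.*` / `WildDyadic.norm_two` (reused by name, not restated).
Use: abc-iut R-J census row Y-29b, sharpening (S) (E-cx g4): the isometric reading of `Ism` is refuted at the
print-shaped dyadic places too, uniformly, via PinsMaxOrder (p451459).
-/

noncomputable section

open Metric Set
open scoped TensorProduct Pointwise

namespace Literature.IUT.LogVolume

namespace DyadicCyclotomic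

/-! ## Arithmetic in `ℚ₂` -/

/-- The norm form of `ℚ₂(ζ₃)/ℚ₂` is anisotropic with the sup value: `‖a² − ab + b²‖ = max(‖a‖,‖b‖)²` (the equal-norm
case is the residue-field fact `𝔽₂ = {0,1}`: `‖u‖ = 1 ⇒ ‖u − 1‖ < 1`, so `‖u² − u + 1‖ = 1`).
[cite: SerreLocalFields1979, Ch. II §1] -/
theorem padicTwo_norm_quad (a b : ℚ_[2]) : ‖a ^ 2 - a * b + b ^ 2‖ = max ‖a‖ ‖b‖ ^ 2 := by
  rcases eq_or_ne b 0 with rfl | hb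
  · simp
  rcases eq_or_ne a 0 with rfl | ha
  · simp
  have hb' : 0 < ‖b‖ := norm_pos_iff.mpr hb
  have ha' : 0 < ‖a‖ := norm_pos_iff.mpr ha
  rcases lt_trichotomy ‖a‖ ‖b‖ with hlt | heq | hgt
  · have hab : ‖a - b‖ = ‖b‖ := by
      rw [sub_eq_add_neg, IsUltrametricDist.norm_add_eq_max_of_norm_ne_norm (by rw [norm_neg]; exact hlt.ne),
        norm_neg, max_eq_right hlt.le]
    have h1 : ‖a * (a - b)‖ < ‖b ^ 2‖ := by
      rw [norm_mul, hab, norm_pow, sq]; exact mul_lt_mul_of_pos_right hlt hb'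
    rw [show a ^ 2 - a * b + b ^ 2 = b ^ 2 + a * (a - b) by ring,
      IsUltrametricDist.norm_add_eq_max_of_norm_ne_norm h1.ne', max_eq_left h1.le, norm_pow, max_eq_right hlt.le]
  · set u := a / b with hu_def
    have hu : ‖u‖ = 1 := by rw [hu_def, norm_div, heq, div_self hb'.ne']
    have hau : a = u * b := by rw [hu_def, div_mul_cancel₀ a hb]
    -- residue field `𝔽₂ = {0, 1}`: a unit of `ℚ₂` is `≡ 1 (mod 2)`, i.e. `‖u − 1‖ < 1`
    have hP : ‖u - 1‖ < 1 := by
      let x : ℤ_[2] := ⟨u, hu.le⟩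
      have hker : x * (x - 1) ∈ RingHom.ker (PadicInt.toZMod : ℤ_[2] →+* ZMod 2) := by
        rw [RingHom.mem_ker, map_mul, map_sub, map_one]
        generalize PadicInt.toZMod x = t
        revert t
        decide
      rw [PadicInt.ker_toZMod, IsLocalRing.mem_maximalIdeal, PadicInt.mem_nonunits, norm_mul] at hker
      have hx1 : ‖x‖ = 1 := hu
      rw [hx1, one_mul] at hker
      have h2 : ‖((x - 1 : ℤ_[2]) : ℚ_[2])‖ < 1 := hker
      rw [PadicInt.coe_sub, PadicInt.coe_one] at h2
      exact h2
    have h1 : ‖u * (u - 1)‖ < ‖(1 : ℚ_[2])‖ := by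
      rw [norm_mul, hu, one_mul, norm_one]; exact hP
    have h2 : ‖u ^ 2 - u + 1‖ = 1 := by
      rw [show u ^ 2 - u + 1 = (1 : ℚ_[2]) + u * (u - 1) by ring,
        IsUltrametricDist.norm_add_eq_max_of_norm_ne_norm h1.ne', max_eq_left h1.le, norm_one]
    rw [hau, show (u * b) ^ 2 - u * b * b + b ^ 2 = b ^ 2 * (u ^ 2 - u + 1) by ring, norm_mul, h2, mul_one,
      norm_pow, norm_mul, hu, one_mul, max_self]
  · have hba : ‖b - a‖ = ‖a‖ := by
      rw [sub_eq_add_neg, IsUltrametricDist.norm_add_eq_max_of_norm_ne_norm (by rw [norm_neg]; exact hgt.ne),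
        norm_neg, max_eq_right hgt.le]
    have h1 : ‖b * (b - a)‖ < ‖a ^ 2‖ := by
      rw [norm_mul, hba, norm_pow, sq]; exact mul_lt_mul_of_pos_right hgt ha'
    rw [show a ^ 2 - a * b + b ^ 2 = a ^ 2 + b * (b - a) by ring,
      IsUltrametricDist.norm_add_eq_max_of_norm_ne_norm h1.ne', max_eq_left h1.le, norm_pow, max_eq_left hgt.le]

/-- `max ‖a + b‖ ‖b‖ = max ‖a‖ ‖b‖` in `ℚ₂` (the unit-layer shear is isometric in coordinates).
[cite: SerreLocalFields1979, Ch. II §1] -/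
theorem padic_max_norm_add (a b : ℚ_[2]) : max ‖a + b‖ ‖b‖ = max ‖a‖ ‖b‖ := by
  rcases lt_or_ge ‖b‖ ‖a‖ with h | h
  · rw [IsUltrametricDist.norm_add_eq_max_of_norm_ne_norm h.ne', max_assoc, max_self]
  · have h1 : ‖a + b‖ ≤ ‖b‖ := (IsUltrametricDist.norm_add_le_max a b).trans (max_le h le_rfl)
    rw [max_eq_right h1, max_eq_right h]

/-- Value-group bookkeeping: `‖a‖² = 2^{−2 v(a)}`. [cite: SerreLocalFields1979, Ch. II §1] -/
theorem norm_sq_eq_zpow {a : ℚ_[2]} (ha : a ≠ 0) : ‖a‖ ^ 2 = (2 : ℝ) ^ (-(2 * a.valuation)) := by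
  have h2 : ((2 : ℕ) : ℝ) = 2 := by norm_num
  rw [Padic.norm_eq_zpow_neg_valuation ha, h2, ← zpow_natCast, ← zpow_mul]
  congr 1; push_cast; ring

/-- `(‖a‖·r)² = 2^{−2 v(a) − 1}` when `r² = 2⁻¹`. [cite: SerreLocalFields1979, Ch. II §1] -/
theorem norm_mul_sq_eq_zpow {a : ℚ_[2]} (ha : a ≠ 0) {r : ℝ} (hr : r ^ 2 = 2⁻¹) :
    (‖a‖ * r) ^ 2 = (2 : ℝ) ^ (-(2 * a.valuation + 1)) := by
  rw [mul_pow, norm_sq_eq_zpow ha, hr, ← zpow_neg_one, ← zpow_add₀ (by norm_num : (2 : ℝ) ≠ 0)]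
  congr 1; ring

/-- PARITY SEPARATION of value groups: `‖a‖ ≠ ‖b‖·r` for `a, b ∈ ℚ₂ˣ` and `r² = 2⁻¹` (`r = ‖π‖`, `e = 2`).
[cite: SerreLocalFields1979, Ch. II §1] -/
theorem norm_ne_norm_mul {a b : ℚ_[2]} (ha : a ≠ 0) (hb : b ≠ 0) {r : ℝ} (hr : r ^ 2 = 2⁻¹) :
    ‖a‖ ≠ ‖b‖ * r := by
  intro h
  have h3 := congrArg (fun x : ℝ => x ^ 2) h
  simp only [norm_sq_eq_zpow ha, norm_mul_sq_eq_zpow hb hr] at h3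
  have hinj := zpow_right_injective₀ (by norm_num : (0 : ℝ) < 2) (by norm_num : (2 : ℝ) ≠ 1) h3
  omega

/-! ## Norms in `K ⊇ ℚ₂(i, ζ)` -/

variable {K : Type} [NontriviallyNormedField K] [NormedAlgebra ℚ_[2] K] {i ζ : K}

/-- `‖3‖ = 1` in a normed `ℚ₂`-algebra. [cite: SerreLocalFields1979, Ch. II §1] -/
theorem norm_three : ‖(3 : K)‖ = 1 := by
  rw [← map_ofNat (algebraMap ℚ_[2] K) 3, norm_algebraMap']
  have h := (Padic.norm_natCast_eq_one_iff (p := 2) (n := 3)).mpr (by norm_num)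
  simpa using h

omit [NormedAlgebra ℚ_[2] K] in
/-- `ζ³ = 1` for `ζ² + ζ + 1 = 0`. [cite: NeukirchANT1999, Ch. II (7.13)] -/
theorem zeta_cube (hζ : ζ ^ 2 + ζ + 1 = 0) : ζ ^ 3 = 1 := by linear_combination (ζ - 1) * hζ

omit [NormedAlgebra ℚ_[2] K] in
/-- `‖ζ‖ = 1`. [cite: NeukirchANT1999, Ch. II (7.13)] -/
theorem norm_zeta (hζ : ζ ^ 2 + ζ + 1 = 0) : ‖ζ‖ = 1 := by
  have h : ‖ζ‖ ^ 3 = 1 := by rw [← norm_pow, zeta_cube hζ, norm_one]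
  exact (pow_eq_one_iff_of_nonneg (norm_nonneg ζ) (by norm_num)).mp h

/-- `‖ζ² − ζ‖ = 1` (`(ζ² − ζ)² = −3`, `‖3‖₂ = 1`). [cite: NeukirchANT1999, Ch. II (7.13)] -/
theorem norm_zeta_sq_sub_zeta (hζ : ζ ^ 2 + ζ + 1 = 0) : ‖ζ ^ 2 - ζ‖ = 1 := by
  have h : ‖ζ ^ 2 - ζ‖ ^ 2 = 1 := by
    rw [← norm_pow, show (ζ ^ 2 - ζ) ^ 2 = -3 by linear_combination (ζ ^ 2 - 3 * ζ + 3) * hζ, norm_neg,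
      norm_three]
  exact (pow_eq_one_iff_of_nonneg (norm_nonneg _) two_ne_zero).mp h

/-- UNIT-LAYER NORM FORMULA: `‖a·1 + b·ζ‖ = max ‖a‖ ‖b‖` — `1, ζ` reduce to an `𝔽₂`-basis of `𝔽₄`; kernel proof via
the norm form `(a·1 + b·ζ)((a−b)·1 − b·ζ) = (a² − ab + b²)·1`. [cite: SerreLocalFields1979, Ch. II §1]
[cite: NeukirchANT1999, Ch. II (7.13)] -/
theorem norm_combo_zeta [IsUltrametricDist K] (hζ : ζ ^ 2 + ζ + 1 = 0) (a b : ℚ_[2]) :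
    ‖a • (1 : K) + b • ζ‖ = max ‖a‖ ‖b‖ := by
  have hζ1 := norm_zeta hζ
  have hup : ∀ a b : ℚ_[2], ‖a • (1 : K) + b • ζ‖ ≤ max ‖a‖ ‖b‖ := fun a b => by
    refine (IsUltrametricDist.norm_add_le_max _ _).trans (le_of_eq ?_)
    rw [norm_smul, norm_one, mul_one, norm_smul, hζ1, mul_one]
  apply le_antisymm (hup a b)
  set m := max ‖a‖ ‖b‖ with hm_def
  rcases eq_or_lt_of_le (show 0 ≤ m from le_max_of_le_left (norm_nonneg a)) with hm0 | hm0
  · rw [← hm0]; exact norm_nonneg _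
  set s := a • (1 : K) + b • ζ with hs_def
  set s' := (a - b) • (1 : K) + (-b) • ζ with hs'_def
  have hprod : s * s' = (a ^ 2 - a * b + b ^ 2) • (1 : K) := by
    simp only [hs_def, hs'_def, Algebra.smul_def, mul_one, map_sub, map_neg, map_add, map_mul, map_pow]
    linear_combination (-(algebraMap ℚ_[2] K b) ^ 2) * hζ
  have hs' : ‖s'‖ ≤ m := by
    refine (hup (a - b) (-b)).trans ?_
    rw [norm_neg]
    refine max_le ?_ (le_max_right _ _)
    rw [sub_eq_add_neg]
    refine (IsUltrametricDist.norm_add_le_max _ _).trans ?_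
    rw [norm_neg]
  have hnorm : ‖s‖ * ‖s'‖ = m ^ 2 := by
    rw [← norm_mul, hprod, norm_smul, norm_one, mul_one, padicTwo_norm_quad]
  have key : m * m ≤ ‖s‖ * m :=
    calc m * m = m ^ 2 := (sq m).symm
      _ = ‖s‖ * ‖s'‖ := hnorm.symm
      _ ≤ ‖s‖ * m := mul_le_mul_of_nonneg_left hs' (norm_nonneg _)
  exact le_of_mul_le_mul_right key hm0

/-- TWO-LAYER NORM FORMULA (`e = f = 2`): for `‖π‖² = 2⁻¹`,
`‖a·1 + b·ζ + c·π + d·ζπ‖ = max (max ‖a‖ ‖b‖) (max ‖c‖ ‖d‖ · ‖π‖)` — the two layers have values in the disjoint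
cosets `2^ℤ` and `2^{ℤ+1/2}`. [cite: SerreLocalFields1979, Ch. II §1] [cite: NeukirchANT1999, Ch. II (7.13)] -/
theorem norm_combo4 [IsUltrametricDist K] (hζ : ζ ^ 2 + ζ + 1 = 0) {π : K} (hπ : ‖π‖ ^ 2 = 2⁻¹)
    (a b c d : ℚ_[2]) :
    ‖a • (1 : K) + b • ζ + c • π + d • (ζ * π)‖ = max (max ‖a‖ ‖b‖) (max ‖c‖ ‖d‖ * ‖π‖) := by
  have hsplit : a • (1 : K) + b • ζ + c • π + d • (ζ * π) = (a • (1 : K) + b • ζ) + (c • (1 : K) + d • ζ) * π := by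
    rw [add_mul, smul_mul_assoc, one_mul, smul_mul_assoc, add_assoc]
  have hy : ‖(c • (1 : K) + d • ζ) * π‖ = max ‖c‖ ‖d‖ * ‖π‖ := by rw [norm_mul, norm_combo_zeta hζ]
  have hmax : ∀ a b : ℚ_[2], ¬ (a = 0 ∧ b = 0) → ∃ e : ℚ_[2], e ≠ 0 ∧ max ‖a‖ ‖b‖ = ‖e‖ := by
    intro a b hab
    rcases le_total ‖a‖ ‖b‖ with h | h
    · refine ⟨b, fun hb => hab ⟨?_, hb⟩, max_eq_right h⟩
      rw [hb, norm_zero] at h; exact norm_le_zero_iff.mp h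
    · refine ⟨a, fun ha => hab ⟨ha, ?_⟩, max_eq_left h⟩
      rw [ha, norm_zero] at h; exact norm_le_zero_iff.mp h
  rw [hsplit, WildCubic.norm_add_eq_max_of _ _ ?_, norm_combo_zeta hζ, hy]
  by_cases hab : a = 0 ∧ b = 0
  · left; rw [hab.1, hab.2, zero_smul, zero_smul, add_zero]
  by_cases hcd : c = 0 ∧ d = 0
  · right; left; rw [hcd.1, hcd.2, zero_smul, zero_smul, add_zero, zero_mul]
  right; right
  rw [norm_combo_zeta hζ, hy]
  obtain ⟨e, he, hmaxe⟩ := hmax a b hab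
  obtain ⟨e', he', hmaxe'⟩ := hmax c d hcd
  rw [hmaxe, hmaxe']
  exact norm_ne_norm_mul he he' hπ

/-- `1, ζ, π, ζπ` are linearly independent over `ℚ₂` (`‖π‖² = 2⁻¹`). [cite: SerreLocalFields1979, Ch. II §1] -/
theorem linearIndependent_four [IsUltrametricDist K] (hζ : ζ ^ 2 + ζ + 1 = 0) {π : K} (hπ : ‖π‖ ^ 2 = 2⁻¹) :
    LinearIndependent ℚ_[2] ![(1 : K), ζ, π, ζ * π] := by
  have hπ0 : 0 < ‖π‖ := by
    refine norm_pos_iff.mpr fun h => ?_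
    rw [h, norm_zero, zero_pow two_ne_zero] at hπ; norm_num at hπ
  rw [Fintype.linearIndependent_iff]
  intro g hg
  have hg' : g 0 • (1 : K) + g 1 • ζ + g 2 • π + g 3 • (ζ * π) = 0 := by simpa [Fin.sum_univ_four] using hg
  have h := norm_combo4 hζ hπ (g 0) (g 1) (g 2) (g 3)
  rw [hg', norm_zero] at h
  have hA : max ‖g 0‖ ‖g 1‖ ≤ 0 := by rw [h]; exact le_max_left _ _
  have hB : max ‖g 2‖ ‖g 3‖ * ‖π‖ ≤ 0 * ‖π‖ := by rw [zero_mul, h]; exact le_max_right _ _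
  have hB' : max ‖g 2‖ ‖g 3‖ ≤ 0 := le_of_mul_le_mul_right hB hπ0
  have e0 : g 0 = 0 := norm_le_zero_iff.mp ((le_max_left _ _).trans hA)
  have e1 : g 1 = 0 := norm_le_zero_iff.mp ((le_max_right _ _).trans hA)
  have e2 : g 2 = 0 := norm_le_zero_iff.mp ((le_max_left _ _).trans hB')
  have e3 : g 3 = 0 := norm_le_zero_iff.mp ((le_max_right _ _).trans hB')
  intro j
  fin_cases j
  · exact e0
  · exact e1
  · exact e2
  · exact e3

/-- THE SHEAR, abstractly: for `‖π‖² = 2⁻¹` there is a `ℚ₂`-linear ISOMETRY of `K` fixing `1, π, ζπ` and sending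
`ζ ↦ ζ + 1` — isometric on `D = ⟨1, ζ, π, ζπ⟩` by the two-layer norm formula, extended to `K` by an orthogonal
complement (`UltrametricComplement.exists_isometry_extension`); no degree hypothesis.
[cite: SerreLocalFields1979, Ch. II §1] [cite: NeukirchANT1999, Ch. II (5.5)] -/
theorem exists_shear_isometry [IsUltrametricDist K] [ProperSpace K] (hζ : ζ ^ 2 + ζ + 1 = 0) {π : K}
    (hπ : ‖π‖ ^ 2 = 2⁻¹) :
    ∃ f₀ : K ≃ₗ[ℚ_[2]] K, f₀ 1 = 1 ∧ f₀ ζ = ζ + 1 ∧ f₀ π = π ∧ f₀ (ζ * π) = ζ * π ∧ ∀ x, ‖f₀ x‖ = ‖x‖ := by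
  have hli := linearIndependent_four hζ hπ
  let D : Submodule ℚ_[2] K := Submodule.span ℚ_[2] (Set.range ![(1 : K), ζ, π, ζ * π])
  let B : Module.Basis (Fin 4) ℚ_[2] D := Module.Basis.span hli
  have hB : ∀ j, ((B j : D) : K) = ![(1 : K), ζ, π, ζ * π] j := fun j =>
    congrArg Subtype.val (Module.Basis.span_apply hli j)
  have hB0 : ((B 0 : D) : K) = 1 := hB 0
  have hB1 : ((B 1 : D) : K) = ζ := hB 1
  have hB2 : ((B 2 : D) : K) = π := hB 2
  have hB3 : ((B 3 : D) : K) = ζ * π := hB 3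
  let w : Fin 4 → D := ![B 0, B 1 + B 0, B 2, B 3]
  have hw0 : ((w 0 : D) : K) = 1 := hB0
  have hw1 : ((w 1 : D) : K) = ζ + 1 := by
    show (((B 1 + B 0 : D)) : K) = ζ + 1
    rw [Submodule.coe_add, hB1, hB0]
  have hw2 : ((w 2 : D) : K) = π := hB2
  have hw3 : ((w 3 : D) : K) = ζ * π := hB3
  let f : D →ₗ[ℚ_[2]] D := B.constr ℚ_[2] w
  have hfB : ∀ j, f (B j) = w j := fun j => B.constr_basis ℚ_[2] w j
  have hf : ∀ d : D, ‖((f d : D) : K)‖ = ‖(d : K)‖ := by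
    intro d
    have hd : (d : K) = B.repr d 0 • (1 : K) + B.repr d 1 • ζ + B.repr d 2 • π + B.repr d 3 • (ζ * π) := by
      have h := congrArg (fun y : D => (y : K)) (B.sum_repr d)
      simp only [Submodule.coe_add, Submodule.coe_smul, Fin.sum_univ_four, hB0, hB1, hB2, hB3] at h
      exact h.symm
    have hfd : ((f d : D) : K) =
        (B.repr d 0 + B.repr d 1) • (1 : K) + B.repr d 1 • ζ + B.repr d 2 • π + B.repr d 3 • (ζ * π) := by
      have h1 : f d = ∑ j, B.repr d j • w j := by
        conv_lhs => rw [← B.sum_repr d]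
        simp only [map_sum, map_smul, hfB]
      have h2 := congrArg (fun y : D => (y : K)) h1
      simp only [Submodule.coe_add, Submodule.coe_smul, Fin.sum_univ_four, hw0, hw1, hw2, hw3] at h2
      rw [h2, smul_add, add_smul]
      abel
    rw [hfd, hd, norm_combo4 hζ hπ, norm_combo4 hζ hπ, padic_max_norm_add]
  obtain ⟨G, hGn, hGD⟩ := UltrametricComplement.exists_isometry_extension D f hf
  have hGB : ∀ j, G ((B j : D) : K) = ((w j : D) : K) := fun j => by rw [hGD, hfB]
  refine ⟨G, ?_, ?_, ?_, ?_, hGn⟩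
  · have h := hGB 0; rwa [hB0, hw0] at h
  · have h := hGB 1; rwa [hB1, hw1] at h
  · have h := hGB 2; rwa [hB2, hw2] at h
  · have h := hGB 3; rwa [hB3, hw3] at h

/-- THE SHEAR of `K ⊇ ℚ₂(i, ζ)`: a `ℚ₂`-linear isometry with `1 ↦ 1, ζ ↦ ζ + 1, i ↦ i, iζ ↦ iζ − 1`
(`π = 1 + i`: `i = π − 1`, `iζ = ζπ − ζ`). [cite: SerreLocalFields1979, Ch. II §1] [cite: NeukirchANT1999, Ch. II (5.5)] -/
theorem exists_shear_isometry_i [IsUltrametricDist K] [ProperSpace K] (hi : i ^ 2 = -1)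
    (hζ : ζ ^ 2 + ζ + 1 = 0) :
    ∃ f₀ : K ≃ₗ[ℚ_[2]] K, f₀ 1 = 1 ∧ f₀ ζ = ζ + 1 ∧ f₀ i = i ∧ f₀ (i * ζ) = i * ζ - 1 ∧ ∀ x, ‖f₀ x‖ = ‖x‖ := by
  obtain ⟨f₀, h1, hz, hπ, hzπ, hn⟩ := exists_shear_isometry hζ (WildGaussian.norm_one_add_i_sq hi)
  refine ⟨f₀, h1, hz, ?_, ?_, hn⟩
  · have h : i = (1 + i) - 1 := by ring
    rw [h, map_sub, hπ, h1]
  · have h : i * ζ = ζ * (1 + i) - ζ := by ring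
    rw [h, map_sub, hzπ, hz]; ring

/-! ## The packet: the idempotent `z` and its displacement under the shear -/

/-- `x ⊗ y` is subtractive in the first slot. [cite: Mochizuki2012, IUTchIV Prop. 1.1 p. 9] -/
theorem purePacket_pair_sub_left (x x' y : K) : purePacket 2 (fun _ : Fin 2 => K) ![x - x', y] = purePacket 2 (fun _ : Fin 2 => K) ![x, y] - purePacket 2 (fun _ : Fin 2 => K) ![x', y] := by
  rw [WildQuadratic.purePacket_pair_eq_iota_mul, WildQuadratic.purePacket_pair_eq_iota_mul, WildQuadratic.purePacket_pair_eq_iota_mul, map_sub, sub_mul]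

/-- `1 ⊗ y = ι₁(y)`. [cite: Mochizuki2012, IUTchIV Prop. 1.1 p. 9] -/
theorem purePacket_one_pair (y : K) : purePacket 2 (fun _ : Fin 2 => K) ![1, y] = iota 2 (fun _ : Fin 2 => K) 1 y := by
  rw [WildQuadratic.purePacket_pair_eq_iota_mul, map_one, one_mul]

/-- `(ζ ⊗ ζ²)(ζ² ⊗ ζ) = 1`. [cite: Mochizuki2012, IUTchIV Prop. 1.1 p. 9] -/
theorem t12_mul_t21 (hζ : ζ ^ 2 + ζ + 1 = 0) : purePacket 2 (fun _ : Fin 2 => K) ![ζ, ζ ^ 2] * purePacket 2 (fun _ : Fin 2 => K) ![ζ ^ 2, ζ] = 1 := by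
  rw [WildQuadratic.purePacket_pair_mul, show ζ * ζ ^ 2 = 1 by linear_combination (ζ - 1) * hζ,
    show ζ ^ 2 * ζ = 1 by linear_combination (ζ - 1) * hζ, WildQuadratic.purePacket_pair_one]

/-- `(ζ ⊗ ζ²)² = ζ² ⊗ ζ`. [cite: Mochizuki2012, IUTchIV Prop. 1.1 p. 9] -/
theorem t12_mul_t12 (hζ : ζ ^ 2 + ζ + 1 = 0) : purePacket 2 (fun _ : Fin 2 => K) ![ζ, ζ ^ 2] * purePacket 2 (fun _ : Fin 2 => K) ![ζ, ζ ^ 2] = purePacket 2 (fun _ : Fin 2 => K) ![ζ ^ 2, ζ] := by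
  rw [WildQuadratic.purePacket_pair_mul, show ζ * ζ = ζ ^ 2 by ring, show ζ ^ 2 * ζ ^ 2 = ζ by linear_combination (ζ ^ 2 - ζ) * hζ]

/-- `(ζ² ⊗ ζ)² = ζ ⊗ ζ²`. [cite: Mochizuki2012, IUTchIV Prop. 1.1 p. 9] -/
theorem t21_mul_t21 (hζ : ζ ^ 2 + ζ + 1 = 0) : purePacket 2 (fun _ : Fin 2 => K) ![ζ ^ 2, ζ] * purePacket 2 (fun _ : Fin 2 => K) ![ζ ^ 2, ζ] = purePacket 2 (fun _ : Fin 2 => K) ![ζ, ζ ^ 2] := by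
  rw [WildQuadratic.purePacket_pair_mul, show ζ * ζ = ζ ^ 2 by ring, show ζ ^ 2 * ζ ^ 2 = ζ by linear_combination (ζ ^ 2 - ζ) * hζ]

/-- THE IDEMPOTENT: `S = 1 + ζ⊗ζ² + ζ²⊗ζ − i⊗i − iζ⊗iζ² − iζ²⊗iζ = (1 − i⊗i)(1 + ζ⊗ζ² + ζ²⊗ζ)` satisfies `S² = 6S`,
so `z = 6⁻¹·S` is idempotent. [cite: Mochizuki2012, IUTchIV Prop. 1.1 p. 9] [cite: NeukirchANT1999, Ch. II (7.13)] -/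
theorem cycIdempotent_mul_self (hi : i ^ 2 = -1) (hζ : ζ ^ 2 + ζ + 1 = 0) :
    ((6 : ℚ_[2])⁻¹ • (purePacket 2 (fun _ : Fin 2 => K) ![1, 1] + purePacket 2 (fun _ : Fin 2 => K) ![ζ, ζ ^ 2] + purePacket 2 (fun _ : Fin 2 => K) ![ζ ^ 2, ζ] - purePacket 2 (fun _ : Fin 2 => K) ![i, i] - purePacket 2 (fun _ : Fin 2 => K) ![i * ζ, i * ζ ^ 2]
        - purePacket 2 (fun _ : Fin 2 => K) ![i * ζ ^ 2, i * ζ]) : PacketAlgebra 2 (fun _ : Fin 2 => K)) *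
      ((6 : ℚ_[2])⁻¹ • (purePacket 2 (fun _ : Fin 2 => K) ![1, 1] + purePacket 2 (fun _ : Fin 2 => K) ![ζ, ζ ^ 2] + purePacket 2 (fun _ : Fin 2 => K) ![ζ ^ 2, ζ] - purePacket 2 (fun _ : Fin 2 => K) ![i, i] - purePacket 2 (fun _ : Fin 2 => K) ![i * ζ, i * ζ ^ 2]
        - purePacket 2 (fun _ : Fin 2 => K) ![i * ζ ^ 2, i * ζ])) =
      (6 : ℚ_[2])⁻¹ • (purePacket 2 (fun _ : Fin 2 => K) ![1, 1] + purePacket 2 (fun _ : Fin 2 => K) ![ζ, ζ ^ 2] + purePacket 2 (fun _ : Fin 2 => K) ![ζ ^ 2, ζ] - purePacket 2 (fun _ : Fin 2 => K) ![i, i] - purePacket 2 (fun _ : Fin 2 => K) ![i * ζ, i * ζ ^ 2]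
        - purePacket 2 (fun _ : Fin 2 => K) ![i * ζ ^ 2, i * ζ]) := by
  set T4 : PacketAlgebra 2 (fun _ : Fin 2 => K) := purePacket 2 (fun _ : Fin 2 => K) ![i, i] with hT4
  set T2 : PacketAlgebra 2 (fun _ : Fin 2 => K) := purePacket 2 (fun _ : Fin 2 => K) ![ζ, ζ ^ 2] with hT2
  set T3 : PacketAlgebra 2 (fun _ : Fin 2 => K) := purePacket 2 (fun _ : Fin 2 => K) ![ζ ^ 2, ζ] with hT3
  have h11 : (purePacket 2 (fun _ : Fin 2 => K) ![1, 1] : PacketAlgebra 2 (fun _ : Fin 2 => K)) = 1 := WildQuadratic.purePacket_pair_one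
  have hIT2 : T4 * T2 = purePacket 2 (fun _ : Fin 2 => K) ![i * ζ, i * ζ ^ 2] := by rw [hT4, hT2, WildQuadratic.purePacket_pair_mul]
  have hIT3 : T4 * T3 = purePacket 2 (fun _ : Fin 2 => K) ![i * ζ ^ 2, i * ζ] := by rw [hT4, hT3, WildQuadratic.purePacket_pair_mul]
  have hAA : (1 - T4) * (1 - T4) = 2 * (1 - T4) := by linear_combination WildGaussian.purePacket_i_i_mul_self (K := K) hi
  have hBB : (1 + T2 + T3) * (1 + T2 + T3) = 3 * (1 + T2 + T3) := by
    linear_combination t12_mul_t12 (K := K) hζ + t21_mul_t21 (K := K) hζ + 2 * t12_mul_t21 (K := K) hζ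
  set S : PacketAlgebra 2 (fun _ : Fin 2 => K) := purePacket 2 (fun _ : Fin 2 => K) ![1, 1] + T2 + T3 - T4 - purePacket 2 (fun _ : Fin 2 => K) ![i * ζ, i * ζ ^ 2] - purePacket 2 (fun _ : Fin 2 => K) ![i * ζ ^ 2, i * ζ] with hS_def
  have hS : S = (1 - T4) * (1 + T2 + T3) := by rw [hS_def, h11]; linear_combination hIT2 + hIT3
  have hSS : S * S = (6 : PacketAlgebra 2 (fun _ : Fin 2 => K)) * S := by
    rw [hS]; linear_combination ((1 + T2 + T3) * (1 + T2 + T3)) * hAA + (2 * (1 - T4)) * hBB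
  have h6 : (6 : PacketAlgebra 2 (fun _ : Fin 2 => K)) * S = (6 : ℚ_[2]) • S := by
    rw [show (6 : PacketAlgebra 2 (fun _ : Fin 2 => K)) = algebraMap ℚ_[2] (PacketAlgebra 2 (fun _ : Fin 2 => K)) 6 from (map_ofNat _ 6).symm, ← Algebra.smul_def]
  rw [smul_mul_smul_comm, hSS, h6, smul_smul, show (6 : ℚ_[2])⁻¹ * 6⁻¹ * 6 = 6⁻¹ by norm_num]

/-- … hence `z = 6⁻¹·S ∈ (R_I)^∼` (root of the monic `X(X − 1)` over `R_I`).
[cite: Mochizuki2012, IUTchIV Prop. 1.1 p. 9, Prop. 1.4 (i) p. 13] -/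
theorem cycIdempotent_mem_normalizedPacket (hi : i ^ 2 = -1) (hζ : ζ ^ 2 + ζ + 1 = 0) :
    ((6 : ℚ_[2])⁻¹ • (purePacket 2 (fun _ : Fin 2 => K) ![1, 1] + purePacket 2 (fun _ : Fin 2 => K) ![ζ, ζ ^ 2] + purePacket 2 (fun _ : Fin 2 => K) ![ζ ^ 2, ζ] - purePacket 2 (fun _ : Fin 2 => K) ![i, i] - purePacket 2 (fun _ : Fin 2 => K) ![i * ζ, i * ζ ^ 2]
        - purePacket 2 (fun _ : Fin 2 => K) ![i * ζ ^ 2, i * ζ]) : PacketAlgebra 2 (fun _ : Fin 2 => K)) ∈ normalizedPacket 2 (fun _ : Fin 2 => K) := by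
  rw [mem_normalizedPacket_iff]
  refine ⟨Polynomial.X * (Polynomial.X - Polynomial.C 1), (Polynomial.monic_X.mul (Polynomial.monic_X_sub_C 1)), ?_⟩
  simp only [Polynomial.eval₂_mul, Polynomial.eval₂_sub, Polynomial.eval₂_X, Polynomial.eval₂_one, map_one]
  rw [mul_sub, mul_one, cycIdempotent_mul_self hi hζ, sub_self]

/-- THE DISPLACEMENT: with `g : 1 ↦ 1, ζ ↦ ζ+1, i ↦ i, iζ ↦ iζ − 1` (so `ζ² ↦ ζ² − 1`, `iζ² ↦ iζ² + 1`),
`(g ⊗ 1)(z) = z + 6⁻¹·ι₁((1+i)(ζ² − ζ))`. [cite: Mochizuki2012, IUTchIV Prop. 1.1 p. 9] -/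
theorem congr_pair_cycIdempotent (hζ : ζ ^ 2 + ζ + 1 = 0) (f : ∀ _ : Fin 2, K ≃ₗ[ℚ_[2]] K) (h1 : f 0 1 = 1)
    (hz : f 0 ζ = ζ + 1) (hfi : f 0 i = i) (hiz : f 0 (i * ζ) = i * ζ - 1) (hf1 : ∀ y, f 1 y = y) :
    (PiTensorProduct.congr f : PacketAlgebra 2 (fun _ : Fin 2 => K) ≃ₗ[ℚ_[2]] PacketAlgebra 2 (fun _ : Fin 2 => K))
        ((6 : ℚ_[2])⁻¹ • (purePacket 2 (fun _ : Fin 2 => K) ![1, 1] + purePacket 2 (fun _ : Fin 2 => K) ![ζ, ζ ^ 2] + purePacket 2 (fun _ : Fin 2 => K) ![ζ ^ 2, ζ] - purePacket 2 (fun _ : Fin 2 => K) ![i, i] - purePacket 2 (fun _ : Fin 2 => K) ![i * ζ, i * ζ ^ 2]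
          - purePacket 2 (fun _ : Fin 2 => K) ![i * ζ ^ 2, i * ζ])) =
      (6 : ℚ_[2])⁻¹ • (purePacket 2 (fun _ : Fin 2 => K) ![1, 1] + purePacket 2 (fun _ : Fin 2 => K) ![ζ, ζ ^ 2] + purePacket 2 (fun _ : Fin 2 => K) ![ζ ^ 2, ζ] - purePacket 2 (fun _ : Fin 2 => K) ![i, i] - purePacket 2 (fun _ : Fin 2 => K) ![i * ζ, i * ζ ^ 2]
          - purePacket 2 (fun _ : Fin 2 => K) ![i * ζ ^ 2, i * ζ]) +
        (6 : ℚ_[2])⁻¹ • iota 2 (fun _ : Fin 2 => K) 1 ((1 + i) * (ζ ^ 2 - ζ)) := by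
  have hz2 : f 0 (ζ ^ 2) = ζ ^ 2 - 1 := by
    rw [show ζ ^ 2 = -ζ - 1 by linear_combination hζ, map_sub, map_neg, hz, h1]; ring
  have hiz2 : f 0 (i * ζ ^ 2) = i * ζ ^ 2 + 1 := by
    rw [show i * ζ ^ 2 = -(i * ζ) - i by linear_combination i * hζ, map_sub, map_neg, hiz, hfi]; ring
  have hG1 : (PiTensorProduct.congr f : PacketAlgebra 2 (fun _ : Fin 2 => K) ≃ₗ[ℚ_[2]] PacketAlgebra 2 (fun _ : Fin 2 => K)) (purePacket 2 (fun _ : Fin 2 => K) ![1, 1]) = purePacket 2 (fun _ : Fin 2 => K) ![1, 1] := by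
    rw [WildQuadratic.congr_pair_purePacket, h1, hf1]
  have hG2 : (PiTensorProduct.congr f : PacketAlgebra 2 (fun _ : Fin 2 => K) ≃ₗ[ℚ_[2]] PacketAlgebra 2 (fun _ : Fin 2 => K)) (purePacket 2 (fun _ : Fin 2 => K) ![ζ, ζ ^ 2]) = purePacket 2 (fun _ : Fin 2 => K) ![ζ, ζ ^ 2] + purePacket 2 (fun _ : Fin 2 => K) ![1, ζ ^ 2] := by
    rw [WildQuadratic.congr_pair_purePacket, hz, hf1, WildQuadratic.purePacket_pair_add_left]
  have hG3 : (PiTensorProduct.congr f : PacketAlgebra 2 (fun _ : Fin 2 => K) ≃ₗ[ℚ_[2]] PacketAlgebra 2 (fun _ : Fin 2 => K)) (purePacket 2 (fun _ : Fin 2 => K) ![ζ ^ 2, ζ]) = purePacket 2 (fun _ : Fin 2 => K) ![ζ ^ 2, ζ] - purePacket 2 (fun _ : Fin 2 => K) ![1, ζ] := by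
    rw [WildQuadratic.congr_pair_purePacket, hz2, hf1, purePacket_pair_sub_left]
  have hG4 : (PiTensorProduct.congr f : PacketAlgebra 2 (fun _ : Fin 2 => K) ≃ₗ[ℚ_[2]] PacketAlgebra 2 (fun _ : Fin 2 => K)) (purePacket 2 (fun _ : Fin 2 => K) ![i, i]) = purePacket 2 (fun _ : Fin 2 => K) ![i, i] := by
    rw [WildQuadratic.congr_pair_purePacket, hfi, hf1]
  have hG5 : (PiTensorProduct.congr f : PacketAlgebra 2 (fun _ : Fin 2 => K) ≃ₗ[ℚ_[2]] PacketAlgebra 2 (fun _ : Fin 2 => K)) (purePacket 2 (fun _ : Fin 2 => K) ![i * ζ, i * ζ ^ 2]) =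
      purePacket 2 (fun _ : Fin 2 => K) ![i * ζ, i * ζ ^ 2] - purePacket 2 (fun _ : Fin 2 => K) ![1, i * ζ ^ 2] := by
    rw [WildQuadratic.congr_pair_purePacket, hiz, hf1, purePacket_pair_sub_left]
  have hG6 : (PiTensorProduct.congr f : PacketAlgebra 2 (fun _ : Fin 2 => K) ≃ₗ[ℚ_[2]] PacketAlgebra 2 (fun _ : Fin 2 => K)) (purePacket 2 (fun _ : Fin 2 => K) ![i * ζ ^ 2, i * ζ]) =
      purePacket 2 (fun _ : Fin 2 => K) ![i * ζ ^ 2, i * ζ] + purePacket 2 (fun _ : Fin 2 => K) ![1, i * ζ] := by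
    rw [WildQuadratic.congr_pair_purePacket, hiz2, hf1, WildQuadratic.purePacket_pair_add_left]
  have hsum : iota 2 (fun _ : Fin 2 => K) 1 ((1 + i) * (ζ ^ 2 - ζ)) =
      purePacket 2 (fun _ : Fin 2 => K) ![1, ζ ^ 2] - purePacket 2 (fun _ : Fin 2 => K) ![1, ζ] + purePacket 2 (fun _ : Fin 2 => K) ![1, i * ζ ^ 2] - purePacket 2 (fun _ : Fin 2 => K) ![1, i * ζ] := by
    rw [show (1 + i) * (ζ ^ 2 - ζ) = ζ ^ 2 - ζ + i * ζ ^ 2 - i * ζ by ring, map_sub, map_add, map_sub,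
      purePacket_one_pair, purePacket_one_pair, purePacket_one_pair, purePacket_one_pair]
  rw [map_smul, map_sub, map_sub, map_sub, map_add, map_add, hG1, hG2, hG3, hG4, hG5, hG6, hsum]
  module

/-- THE EXIT COORDINATE: `6⁻¹·ι₁((1+i)(ζ²−ζ)) ∉ (R_I)^∼`, its `L_j`-coordinates having norm
`‖6⁻¹‖·‖1+i‖·‖ζ²−ζ‖ = 2·2^{−1/2} = √2 > 1`. [cite: Mochizuki2012, IUTchIV Prop. 1.1 p. 9] -/
theorem shear_defect_not_mem [IsUltrametricDist K] [ProperSpace K] (hi : i ^ 2 = -1) (hζ : ζ ^ 2 + ζ + 1 = 0) :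
    (6 : ℚ_[2])⁻¹ • iota 2 (fun _ : Fin 2 => K) 1 ((1 + i) * (ζ ^ 2 - ζ)) ∉ normalizedPacket 2 (fun _ : Fin 2 => K) := by
  intro hmem
  rw [← map_smul] at hmem
  obtain ⟨j⟩ := nonempty_dIdx 2 (fun _ : Fin 2 => K)
  have hle := norm_dEquiv_le_one_of_mem_normalizedPacket 2 (fun _ : Fin 2 => K) hmem j
  rw [norm_dEquiv_iota, norm_smul, norm_mul, norm_inv, norm_zeta_sq_sub_zeta hζ, mul_one] at hle
  have h6 : ‖(6 : ℚ_[2])‖ = 2⁻¹ := by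
    have h2 : ‖(2 : ℚ_[2])‖ = 2⁻¹ := by simpa using Padic.norm_p (p := 2)
    have h3 : ‖(3 : ℚ_[2])‖ = 1 := by
      simpa using (Padic.norm_natCast_eq_one_iff (p := 2) (n := 3)).mpr (by norm_num)
    rw [show (6 : ℚ_[2]) = 2 * 3 by norm_num, norm_mul, h2, h3, mul_one]
  rw [h6, inv_inv] at hle
  have hsq : (2 * ‖1 + i‖) ^ 2 = 2 := by rw [mul_pow, WildGaussian.norm_one_add_i_sq hi]; norm_num
  have h1 : (2 * ‖1 + i‖) ^ 2 ≤ 1 ^ 2 := pow_le_pow_left₀ (by positivity) hle 2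
  rw [hsq] at h1; norm_num at h1

/-- … so `(g ⊗ 1)(z) ∉ (R_I)^∼` while `z ∈ (R_I)^∼`. [cite: Mochizuki2012, IUTchIV Prop. 1.1 p. 9] -/
theorem congr_pair_cycIdempotent_not_mem [IsUltrametricDist K] [ProperSpace K] (hi : i ^ 2 = -1)
    (hζ : ζ ^ 2 + ζ + 1 = 0) (f : ∀ _ : Fin 2, K ≃ₗ[ℚ_[2]] K) (h1 : f 0 1 = 1) (hz : f 0 ζ = ζ + 1)
    (hfi : f 0 i = i) (hiz : f 0 (i * ζ) = i * ζ - 1) (hf1 : ∀ y, f 1 y = y) :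
    (PiTensorProduct.congr f : PacketAlgebra 2 (fun _ : Fin 2 => K) ≃ₗ[ℚ_[2]] PacketAlgebra 2 (fun _ : Fin 2 => K))
        ((6 : ℚ_[2])⁻¹ • (purePacket 2 (fun _ : Fin 2 => K) ![1, 1] + purePacket 2 (fun _ : Fin 2 => K) ![ζ, ζ ^ 2] + purePacket 2 (fun _ : Fin 2 => K) ![ζ ^ 2, ζ] - purePacket 2 (fun _ : Fin 2 => K) ![i, i] - purePacket 2 (fun _ : Fin 2 => K) ![i * ζ, i * ζ ^ 2]
          - purePacket 2 (fun _ : Fin 2 => K) ![i * ζ ^ 2, i * ζ])) ∉ normalizedPacket 2 (fun _ : Fin 2 => K) := by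
  intro hmem
  have hzmem := cycIdempotent_mem_normalizedPacket hi hζ
  rw [congr_pair_cycIdempotent hζ f h1 hz hfi hiz hf1] at hmem
  have h := sub_mem hmem hzmem
  rw [add_sub_cancel_left] at h
  exact shear_defect_not_mem hi hζ h

/-- Packaged: a point of `(R_I)^∼` moved out of `(R_I)^∼` by `congr f` for any pair `f` whose first component is the
shear and whose second is the identity. [cite: Mochizuki2012, IUTchIV Prop. 1.1 p. 9] -/
theorem exists_mem_normalizedPacket_congr_not_mem [IsUltrametricDist K] [ProperSpace K] (hi : i ^ 2 = -1)
    (hζ : ζ ^ 2 + ζ + 1 = 0) (f : ∀ _ : Fin 2, K ≃ₗ[ℚ_[2]] K) (h1 : f 0 1 = 1) (hz : f 0 ζ = ζ + 1)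
    (hfi : f 0 i = i) (hiz : f 0 (i * ζ) = i * ζ - 1) (hf1 : ∀ y, f 1 y = y) :
    ∃ z : PacketAlgebra 2 (fun _ : Fin 2 => K), z ∈ (normalizedPacket 2 (fun _ : Fin 2 => K) : Set (PacketAlgebra 2 (fun _ : Fin 2 => K))) ∧
      (PiTensorProduct.congr f : PacketAlgebra 2 (fun _ : Fin 2 => K) ≃ₗ[ℚ_[2]] PacketAlgebra 2 (fun _ : Fin 2 => K)) z ∉ (normalizedPacket 2 (fun _ : Fin 2 => K) : Set (PacketAlgebra 2 (fun _ : Fin 2 => K))) :=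
  ⟨_, cycIdempotent_mem_normalizedPacket hi hζ, congr_pair_cycIdempotent_not_mem hi hζ f h1 hz hfi hiz hf1⟩

/-- **THE PRINT-SHAPED WILD DYADIC ISOMETRY MOVER** (no degree hypothesis): for `K ∋ i, ζ` (`i² = −1`,
`ζ² + ζ + 1 = 0`) ultrametric and proper over `ℚ₂`, there is a `ℚ₂`-linear ISOMETRY `f₀` of `K` — mapping every closed
ball `closedBall 0 r` (so `𝒪_K` and every `𝔪_K^n`) onto itself — and a point `z ∈ (R_I)^∼` of `K ⊗_{ℚ₂} K` with
`(f₀ ⊗ 1)(z) ∉ (R_I)^∼`. [cite: Mochizuki2012, IUTchIV Prop. 1.1 p. 9] [cite: NeukirchANT1999, Ch. II (5.5)] -/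
theorem exists_isometry_maxOrder_mover [IsUltrametricDist K] [ProperSpace K] (hi : i ^ 2 = -1)
    (hζ : ζ ^ 2 + ζ + 1 = 0) :
    ∃ f₀ : K ≃ₗ[ℚ_[2]] K, (∀ x, ‖f₀ x‖ = ‖x‖) ∧ (∀ r : ℝ, f₀ '' closedBall (0 : K) r = closedBall 0 r) ∧
      ∃ z : PacketAlgebra 2 (fun _ : Fin 2 => K),
        z ∈ (normalizedPacket 2 (fun _ : Fin 2 => K) : Set (PacketAlgebra 2 (fun _ : Fin 2 => K))) ∧
          (PiTensorProduct.congr (![f₀, LinearEquiv.refl ℚ_[2] K] : ∀ _ : Fin 2, K ≃ₗ[ℚ_[2]] K) :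
              PacketAlgebra 2 (fun _ : Fin 2 => K) ≃ₗ[ℚ_[2]] PacketAlgebra 2 (fun _ : Fin 2 => K)) z ∉
            (normalizedPacket 2 (fun _ : Fin 2 => K) : Set (PacketAlgebra 2 (fun _ : Fin 2 => K))) := by
  obtain ⟨f₀, h1, hz, hfi, hiz, hiso⟩ := exists_shear_isometry_i (K := K) hi hζ
  exact ⟨f₀, hiso, image_closedBall_eq_of_norm_map_eq 2 f₀ hiso,
    DyadicCyclotomic.exists_mem_normalizedPacket_congr_not_mem hi hζ _ h1 hz hfi hiz (fun _ => rfl)⟩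

end DyadicCyclotomic

/-! ## Non-vacuity: `ℚ₂(ζ₁₂) ⊆ ℚ̄₂` -/

open Polynomial IntermediateField in
/-- **`ℚ₂(ζ₁₂) ⊆ ℚ̄₂`**: there is `E ⊆ ℚ̄₂` finite over `ℚ₂` containing `i, ζ` with `i² = −1`, `ζ² + ζ + 1 = 0`
(`E = ℚ₂(θ)`, `θ⁴ − θ² + 1 = 0`, `i = θ³`, `ζ = θ⁴`). [cite: NeukirchANT1999, Ch. II (7.13)] -/
theorem exists_dyadicCyclotomic_subfield :
    ∃ (E : IntermediateField ℚ_[2] (PadicAlgCl 2)) (i ζ : E), FiniteDimensional ℚ_[2] E ∧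
      i ^ 2 = -1 ∧ ζ ^ 2 + ζ + 1 = 0 := by
  have hdeg : ((X ^ 4 - X ^ 2 + 1 : (PadicAlgCl 2)[X])).degree = 4 := by
    compute_degree!
  obtain ⟨θ, hθ⟩ := IsAlgClosed.exists_root (X ^ 4 - X ^ 2 + 1 : (PadicAlgCl 2)[X])
    (by rw [hdeg]; decide)
  have hθ' : θ ^ 4 - θ ^ 2 + 1 = 0 := by
    have h := hθ.eq_zero
    simpa using h
  have heval : Polynomial.aeval θ (X ^ 4 - X ^ 2 + 1 : ℚ_[2][X]) = 0 := by
    simp [hθ']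
  have hmonic : (X ^ 4 - X ^ 2 + 1 : ℚ_[2][X]).Monic := by
    monicity!
  have hint : IsIntegral ℚ_[2] θ := ⟨X ^ 4 - X ^ 2 + 1, hmonic, by simpa [Polynomial.aeval_def] using heval⟩
  haveI hfd : FiniteDimensional ℚ_[2] ℚ_[2]⟮θ⟯ := adjoin.finiteDimensional hint
  set θE : ℚ_[2]⟮θ⟯ := ⟨θ, mem_adjoin_simple_self ℚ_[2] θ⟩ with hθE_def
  have hθE : θE ^ 4 - θE ^ 2 + 1 = 0 := by
    apply Subtype.ext
    simp [hθE_def, hθ']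
  refine ⟨ℚ_[2]⟮θ⟯, θE ^ 3, θE ^ 4, hfd, ?_, ?_⟩
  · linear_combination (θE ^ 2 + 1) * hθE
  · linear_combination (θE ^ 4 + θE ^ 2 + 1) * hθE

/-- **NON-VACUITY OF THE PRINT-SHAPED WILD DYADIC ISOMETRY MOVER.**  For some finite `E ⊆ ℚ̄₂` (namely
`E = ℚ₂(ζ₁₂)`, the smallest field a completion `F_w`, `w ∣ 2`, of print-shaped initial Θ-data can be) there are
`i, ζ ∈ E` (`i² = −1`, `ζ² + ζ + 1 = 0`), a `ℚ₂`-linear ISOMETRY `g` of `E` with `g 1 = 1, g i = i, g ζ = ζ + 1` (the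
unit-layer shear; it maps `𝒪_E` and every `𝔪_E^n` onto themselves) and a point `z` of the maximal order `(R_I)^∼` of
`E ⊗_{ℚ₂} E` with `(g ⊗ 1)(z) ∉ (R_I)^∼`.
[cite: Mochizuki2012, IUTchIV Prop. 1.1 p. 9] [cite: NeukirchANT1999, Ch. II (7.13)] -/
theorem exists_dyadicCyclotomic_isometry_maxOrder_mover :
    ∃ (E : IntermediateField ℚ_[2] (PadicAlgCl 2)) (_ : FiniteDimensional ℚ_[2] E) (i ζ : E) (g : E ≃ₗ[ℚ_[2]] E),
      i ^ 2 = -1 ∧ ζ ^ 2 + ζ + 1 = 0 ∧ g 1 = 1 ∧ g i = i ∧ g ζ = ζ + 1 ∧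
      (∀ x, ‖g x‖ = ‖x‖) ∧ (∀ r : ℝ, g '' closedBall (0 : E) r = closedBall 0 r) ∧
        ∃ z : PacketAlgebra 2 (fun _ : Fin 2 => (E : Type)),
          z ∈ (normalizedPacket 2 (fun _ : Fin 2 => (E : Type)) : Set (PacketAlgebra 2 (fun _ : Fin 2 => (E : Type)))) ∧
            (PiTensorProduct.congr (![g, LinearEquiv.refl ℚ_[2] E] : ∀ _ : Fin 2, (E : Type) ≃ₗ[ℚ_[2]] E) :
                PacketAlgebra 2 (fun _ : Fin 2 => (E : Type)) ≃ₗ[ℚ_[2]] PacketAlgebra 2 (fun _ : Fin 2 => (E : Type))) z ∉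
              (normalizedPacket 2 (fun _ : Fin 2 => (E : Type)) : Set (PacketAlgebra 2 (fun _ : Fin 2 => (E : Type)))) := by
  obtain ⟨E, i, ζ, hfd, hi, hζ⟩ := exists_dyadicCyclotomic_subfield
  obtain ⟨f₀, h1, hz, hfi, hiz, hiso⟩ := DyadicCyclotomic.exists_shear_isometry_i (K := E) hi hζ
  exact ⟨E, hfd, i, ζ, f₀, hi, hζ, h1, hfi, hz, hiso, image_closedBall_eq_of_norm_map_eq 2 f₀ hiso,
    DyadicCyclotomic.exists_mem_normalizedPacket_congr_not_mem hi hζ _ h1 hz hfi hiz (fun _ => rfl)⟩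

end Literature.IUT.LogVolume

end
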